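import Literature.Analysis.ValidatedNumerics.TaylorModelIntegralCert
import Literature.Analysis.ValidatedNumerics.TaylorModelLog
import HarnessLib

/-!
# Kernel-checkable integral certificates for elementary expressions with `log` and `exp` nodes

Trunk T-ANA (Analysis/ValidatedNumerics); namespace `Literature.Analysis.ValidatedNumerics.PolyMP`.
Sequel of `TaylorModelIntegralCert.lean` (grammar `WExpr`: rational polynomials, `e^{a+bt}`, `−`, `+`, `×`, `1/·`,
`√·`) and `TaylorModelLog.lean` (Taylor models of `log ∘ g`, `exp ∘ g`).  The same certificate SHAPE — an untrusted
generator proposes panel data, the kernel re-computes the piecewise Taylor-model enclosure and compares it with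
the claimed bounds (certificate-checked integration as in Mahboubi–Melquiond–Sibut-Pinote; Taylor models of
expressions by structural recursion as in Joldeş, Algorithm 2.2.10, the intrinsics composed as in Algorithm 2.2.8) —
for the LARGER grammar `EExpr = WExpr + log A + exp A`:

* `EExpr`, `EExpr.toFun` (Mathlib's `Real.log`, `Real.exp`; `log` of a non-positive value is a junk value that no
  accepted certificate meets: acceptance of a `log` node proves its argument positive on the panel),
  `EExpr.model S h D K Ke ke Kl c E cs` (the panel Taylor model of `u ↦ E(c+u)`, reciprocal / square-root candidates
  consumed from `cs` as in `WExpr.model`; `log` / `exp` nodes need no candidates: `tlogTM` / `texpTM`),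
  `EExpr.tmem_model`;
* `certDataE`, `certCheckE S h D K Ke ke Kl E q css lo hi` and **`integral_bounds_of_certCheckE`**:
  `certCheckE … = true → lo ≤ ∫₀^{2nh} E(t) q(t) dt ≤ hi` (`n = css.length` panels of half-width `h`, `q` an exact
  rational polynomial weight) — no side hypotheses;
* the SHARDED form (one kernel check per panel): `panelCheckE … j cs plo phi`, `SegOK` (scaled segment integral in
  `[lo, hi]` + integrability), `segOK_of_panelCheckE`, `SegOK.append` (adjacent intervals), `SegOK.bounds`.

Parameters: scale `S`, truncation degree `D`, `K` series terms (for `e^{bu}`, `log(1+u)`, `e^{u}` alike), `Ke`/`ke`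
terms/squarings for the constants `e^{c}`, `Kl` terms for the constants `log c`.  Still deliberately NOT here:
endpoint singularities and non-polynomial weights (see `TaylorModelLogEdge.lean`), adaptivity (the generator's job).
Problem-independent; no facts, no axioms.

## References

* A. Mahboubi, G. Melquiond, T. Sibut-Pinote, *Formally verified approximations of definite integrals*, ITP 2016,
  LNCS 9807, 274–289: Sect. 3.2 Lemma 3, Sect. 3.3, Sect. 4 (3). [cite: MahboubiMelquiondSibutpinote2016, Sect. 3.2 Lemma 3]
* M. Joldeş, *Rigorous Polynomial Approximations and Applications*, PhD thesis, ENS Lyon (2011), Definition 2.1.3,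
  Algorithm 2.2.8 (`TMComp`, composition of a Taylor model with a basic function, thesis p. 60) and Algorithm 2.2.10
  (Taylor models of expressions by structural recursion, thesis p. 62). [cite: Joldes2011, Algorithm 2.2.10]
* K. Makino, M. Berz, *Taylor models and other validated functional inclusion methods*, Int. J. Pure Appl. Math. 4
  (2003) 379–456 (the origin of Taylor-model intrinsics). [cite: MakinoBerz2003, passim]
-/

open MeasureTheory intervalIntegral Set

namespace Literature.Analysis.ValidatedNumerics

namespace PolyMP

open Literature.Analysis.ValidatedNumerics.NumericsMP
open Literature.Analysis.ValidatedNumerics.ExpPoly (Poly BPoly)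
open Literature.Analysis.ValidatedNumerics.ExpPoly

/-- [folklore] -/
private theorem eval_recenterAt' (g : Poly) (c : ℚ) (u : ℝ) :
    Poly.eval (recenterAt g c) u = Poly.eval g ((c : ℝ) + u) := by
  rw [recenterAt, BPoly.eval_subst, BPoly.eval_taylor]
  simp [Poly.eval, add_comm]

/-- [folklore] -/
private theorem mem_expQ' {S : ℕ} (hS : 0 < S) {Ke ke : ℕ} {x : ℚ}
    (h : (MI.expPt S Ke ke (ofRat S x)).isSome = true) : MI.mem S (Real.exp x) (expQ S Ke ke x) := by
  obtain ⟨Y, hY⟩ := Option.isSome_iff_exists.1 h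
  rw [expQ, hY, Option.getD_some]
  exact MI.mem_expPt hS hY (mem_ofRat S x)

/-! ### The expression language -/

/-- Integrand expressions in one real variable `t`: the grammar `WExpr` of `TaylorModelIntegralCert.lean`
(exact rational polynomials, `e^{a + b t}`, negation, sum, product, reciprocal, square root) extended by the
intrinsics `log A` and `exp A`. [cite: Joldes2011, Algorithm 2.2.10] -/
inductive EExpr : Type
  /-- an exact rational polynomial `g(t)` -/
  | poly (g : Poly) : EExpr
  /-- `e^{a + b t}`, `a b : ℚ` (cheap path: the exponential in the identity variable) -/
  | expAff (a b : ℚ) : EExpr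
  /-- `−A` -/
  | neg (A : EExpr) : EExpr
  /-- `A + B` -/
  | add (A B : EExpr) : EExpr
  /-- `A · B` -/
  | mul (A B : EExpr) : EExpr
  /-- `1 / A` (a certificate node: consumes one thin candidate per panel) -/
  | inv (A : EExpr) : EExpr
  /-- `√A` (a certificate node: consumes one thin candidate per panel) -/
  | sqrt (A : EExpr) : EExpr
  /-- `log A` (accepted only where `A > 0` is certified) -/
  | log (A : EExpr) : EExpr
  /-- `e^{A}` -/
  | exp (A : EExpr) : EExpr
  deriving Inhabited

namespace EExpr

/-- The real function denoted by an expression. [folklore] -/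
noncomputable def toFun : EExpr → ℝ → ℝ
  | poly g => fun t => Poly.eval g t
  | expAff a b => fun t => Real.exp ((a : ℝ) + b * t)
  | neg A => fun t => -toFun A t
  | add A B => fun t => toFun A t + toFun B t
  | mul A B => fun t => toFun A t * toFun B t
  | inv A => fun t => (toFun A t)⁻¹
  | sqrt A => fun t => Real.sqrt (toFun A t)
  | log A => fun t => Real.log (toFun A t)
  | exp A => fun t => Real.exp (toFun A t)

/-- [folklore] -/
private theorem measurable_toFun : ∀ E : EExpr, Measurable E.toFun
  | poly g => (Poly.continuous_eval g).measurable
  | expAff a b => by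
      show Measurable fun t : ℝ => Real.exp ((a : ℝ) + b * t)
      exact Real.measurable_exp.comp (measurable_const.add (measurable_const.mul measurable_id))
  | neg A => (measurable_toFun A).neg
  | add A B => (measurable_toFun A).add (measurable_toFun B)
  | mul A B => (measurable_toFun A).mul (measurable_toFun B)
  | inv A => (measurable_toFun A).inv
  | sqrt A => Real.continuous_sqrt.measurable.comp (measurable_toFun A)
  | log A => Real.measurable_log.comp (measurable_toFun A)
  | exp A => Real.measurable_exp.comp (measurable_toFun A)

/-- **The panel Taylor model of `u ↦ E(c + u)` on `|u| ≤ h`** (scale `S`, truncation degree `D`, `K` series terms,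
`Ke`/`ke` for the constants `e^{x}`, `Kl` for the constants `log x`), consuming the reciprocal / square-root
candidates `cs` in traversal order; result record as for `WExpr.model`. [cite: Joldes2011, Algorithm 2.2.10] -/
def model (S : ℕ) (h : ℚ) (D K Ke ke Kl : ℕ) (c : ℚ) : EExpr → List (List ℤ × ℕ) → WExpr.MRes
  | poly g, cs => ⟨ratPolyI S (recenterAt g c), cs, true⟩
  | expAff a b, cs => ⟨tsmulI S (expQ S Ke ke (a + b * c)) (texpI S h K b), cs,
      (MI.expPt S Ke ke (ofRat S (a + b * c))).isSome && decide (|b * h| ≤ 1) && decide (0 < K)⟩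
  | neg A, cs =>
      let r := model S h D K Ke ke Kl c A cs
      ⟨tnegI r.P, r.rest, r.ok⟩
  | add A B, cs =>
      let r := model S h D K Ke ke Kl c A cs
      let r' := model S h D K Ke ke Kl c B r.rest
      ⟨taddI r.P r'.P, r'.rest, r.ok && r'.ok⟩
  | mul A B, cs =>
      let r := model S h D K Ke ke Kl c A cs
      let r' := model S h D K Ke ke Kl c B r.rest
      ⟨tmulI S h D r.P r'.P, r'.rest, r.ok && r'.ok⟩
  | inv A, cs =>
      let r := model S h D K Ke ke Kl c A cs
      match r.rest with
      | [] => ⟨[], [], false⟩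
      | d :: cs' => ⟨widen0 (thinI d.1) d.2, cs', r.ok && checkInv S h D r.P (thinI d.1) d.2⟩
  | sqrt A, cs =>
      let r := model S h D K Ke ke Kl c A cs
      match r.rest with
      | [] => ⟨[], [], false⟩
      | d :: cs' => ⟨widen0 (thinI d.1) d.2, cs', r.ok && checkSqrt S h D r.P (thinI d.1) d.2⟩
  | log A, cs =>
      let r := model S h D K Ke ke Kl c A cs
      let t := tlogTM S h D K Kl r.P
      ⟨t.1, r.rest, r.ok && t.2⟩
  | exp A, cs =>
      let r := model S h D K Ke ke Kl c A cs
      let t := texpTM S h D K Ke ke r.P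
      ⟨t.1, r.rest, r.ok && t.2⟩

/-- **Soundness of `model`**: an accepted model encloses `u ↦ E(c + u)` on `|u| ≤ h`.
[cite: Joldes2011, Algorithm 2.2.10] -/
theorem tmem_model {S : ℕ} (hS : 0 < S) {h : ℚ} (h0 : 0 ≤ h) {D K Ke ke Kl : ℕ} (c : ℚ) :
    ∀ (E : EExpr) (cs : List (List ℤ × ℕ)), (model S h D K Ke ke Kl c E cs).ok = true →
      TMem S h (fun u => E.toFun ((c : ℝ) + u)) (model S h D K Ke ke Kl c E cs).P
  | poly g, cs, _ => by
      have hm := tmem_ratPoly S h (recenterAt g c)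
      simp only [eval_recenterAt'] at hm
      exact hm
  | expAff a b, cs, hok => by
      simp only [model, Bool.and_eq_true, decide_eq_true_eq] at hok
      obtain ⟨⟨hsome, hbh⟩, hK⟩ := hok
      have hm := tmem_smulI hS (mem_expQ' hS hsome) (tmem_exp (S := S) (h := h) hK hbh)
      intro ρ hρ
      obtain ⟨as, has, hev⟩ := hm ρ hρ
      refine ⟨as, has, ?_⟩
      rw [← hev]
      show Real.exp ((a : ℝ) + b * ((c : ℝ) + ρ)) = _
      push_cast
      rw [← Real.exp_add]
      congr 1
      ring
  | neg A, cs, hok => by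
      simp only [model] at hok ⊢
      exact tmem_neg (tmem_model hS h0 c A cs hok)
  | add A B, cs, hok => by
      simp only [model, Bool.and_eq_true] at hok ⊢
      exact tmem_add (tmem_model hS h0 c A cs hok.1) (tmem_model hS h0 c B _ hok.2)
  | mul A B, cs, hok => by
      simp only [model, Bool.and_eq_true] at hok ⊢
      exact tmem_mul hS h0 D (tmem_model hS h0 c A cs hok.1) (tmem_model hS h0 c B _ hok.2)
  | inv A, cs, hok => by
      have ih := tmem_model hS h0 c A cs (D := D) (K := K) (Ke := Ke) (ke := ke) (Kl := Kl)
      simp only [model] at hok ⊢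
      rcases hr : (model S h D K Ke ke Kl c A cs).rest with _ | ⟨d, cs'⟩
      · simp [hr] at hok
      · simp only [hr, Bool.and_eq_true] at hok ⊢
        exact tmem_inv_of_check hS h0 (ih hok.1) (tmem_thin hS h d.1) hok.2
  | sqrt A, cs, hok => by
      have ih := tmem_model hS h0 c A cs (D := D) (K := K) (Ke := Ke) (ke := ke) (Kl := Kl)
      simp only [model] at hok ⊢
      rcases hr : (model S h D K Ke ke Kl c A cs).rest with _ | ⟨d, cs'⟩
      · simp [hr] at hok
      · simp only [hr, Bool.and_eq_true] at hok ⊢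
        exact tmem_sqrt_of_check hS h0 (ih hok.1) (tmem_thin hS h d.1) hok.2
  | log A, cs, hok => by
      have ih := tmem_model hS h0 c A cs (D := D) (K := K) (Ke := Ke) (ke := ke) (Kl := Kl)
      simp only [model, Bool.and_eq_true] at hok ⊢
      exact tmem_log_of_tlogTM hS h0 (ih hok.1) hok.2
  | exp A, cs, hok => by
      have ih := tmem_model hS h0 c A cs (D := D) (K := K) (Ke := Ke) (ke := ke) (Kl := Kl)
      simp only [model, Bool.and_eq_true] at hok ⊢
      exact tmem_exp_of_texpTM hS h0 (ih hok.1) hok.2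

end EExpr

/-! ### The certificate -/

/-- The panel data `(W_j, pw_j)` of panels `j₀, j₀+1, …` with its conjunctive acceptance flag; one candidate list per
panel. [folklore] -/
def certDataE (S : ℕ) (h : ℚ) (D K Ke ke Kl : ℕ) (E : EExpr) :
    List (List (List ℤ × ℕ)) → ℕ → List (IPoly × Poly) × Bool
  | [], _ => ([], true)
  | cs :: css, j =>
      let r := EExpr.model S h D K Ke ke Kl (panelCentre h j) E cs
      let t := certDataE S h D K Ke ke Kl E css (j + 1)
      ((r.P, midPoly S r.P) :: t.1, r.ok && t.2)

/-- [folklore] -/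
private theorem length_certDataE (S : ℕ) (h : ℚ) (D K Ke ke Kl : ℕ) (E : EExpr) :
    ∀ (css : List (List (List ℤ × ℕ))) (j : ℕ), (certDataE S h D K Ke ke Kl E css j).1.length = css.length
  | [], _ => rfl
  | _ :: css, j => by simp [certDataE, length_certDataE S h D K Ke ke Kl E css (j + 1)]

/-- [folklore] -/
private theorem tmem_certDataE {S : ℕ} (hS : 0 < S) {h : ℚ} (h0 : 0 ≤ h) {D K Ke ke Kl : ℕ} (E : EExpr) :
    ∀ (css : List (List (List ℤ × ℕ))) (j₀ : ℕ), (certDataE S h D K Ke ke Kl E css j₀).2 = true →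
      ∀ i : Fin (certDataE S h D K Ke ke Kl E css j₀).1.length,
        TMem S h (fun u => E.toFun ((panelCentre h (j₀ + (i : ℕ)) : ℝ) + u))
          ((certDataE S h D K Ke ke Kl E css j₀).1.get i).1
  | [], _, _, i => i.elim0
  | cs :: css, j₀, hok, ⟨0, _⟩ => by
      simp only [certDataE, Bool.and_eq_true] at hok
      simpa [certDataE] using EExpr.tmem_model hS h0 (panelCentre h j₀) E cs hok.1
  | cs :: css, j₀, hok, ⟨i + 1, hi⟩ => by
      simp only [certDataE, Bool.and_eq_true] at hok
      have hi' : i < (certDataE S h D K Ke ke Kl E css (j₀ + 1)).1.length := by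
        simpa [certDataE] using hi
      have ih := tmem_certDataE hS h0 E css (j₀ + 1) hok.2 ⟨i, hi'⟩
      have e : j₀ + 1 + i = j₀ + (i + 1) := by omega
      simpa [certDataE, e] using ih

/-- **The certificate** for `lo ≤ ∫₀^{2nh} E(t) q(t) dt ≤ hi` (`n = css.length`): positivity of `S` and `h`, every
panel model accepted, and the kernel enclosure inside `[lo·S, hi·S]`. [folklore] -/
def certCheckE (S : ℕ) (h : ℚ) (D K Ke ke Kl : ℕ) (E : EExpr) (q : Poly) (css : List (List (List ℤ × ℕ)))
    (lo hi : ℚ) : Bool :=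
  let d := certDataE S h D K Ke ke Kl E css 0
  let I := fullPanelsI S h q d.1 0
  decide (0 < S) && decide (0 < h) && d.2 && decide (lo * S ≤ (I.lo : ℚ)) && decide ((I.hi : ℚ) ≤ hi * S)

/-- **Soundness of the certificate** (no side hypotheses): the piecewise polynomial integral enclosure re-computed
by the kernel from untrusted data, for the grammar with `log` / `exp` nodes.
[cite: MahboubiMelquiondSibutpinote2016, Sect. 3.2 Lemma 3, Sect. 4 (3)] -/
theorem integral_bounds_of_certCheckE {S : ℕ} {h : ℚ} {D K Ke ke Kl : ℕ} {E : EExpr} {q : Poly}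
    {css : List (List (List ℤ × ℕ))} {lo hi : ℚ} (hc : certCheckE S h D K Ke ke Kl E q css lo hi = true) :
    (lo : ℝ) ≤ ∫ t in (0 : ℝ)..(2 * css.length * (h : ℝ)), E.toFun t * Poly.eval q t ∧
      ∫ t in (0 : ℝ)..(2 * css.length * (h : ℝ)), E.toFun t * Poly.eval q t ≤ (hi : ℝ) := by
  unfold certCheckE at hc
  simp only [Bool.and_eq_true, decide_eq_true_eq] at hc
  obtain ⟨⟨⟨⟨hS, h0⟩, hok⟩, hlo⟩, hhi⟩ := hc
  have hD := tmem_certDataE hS h0.le E css 0 hok (D := D) (K := K) (Ke := Ke) (ke := ke) (Kl := Kl)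
  simp only [Nat.zero_add] at hD
  obtain ⟨hm, -⟩ := mem_fullPanelsI_of_tmem hS h0.le (EExpr.measurable_toFun E) q
    (certDataE S h D K Ke ke Kl E css 0).1 0 (fun i => by simpa using hD i)
  rw [length_certDataE] at hm
  have e1 : (2 * ((0 : ℕ) : ℝ) * (h : ℝ)) = 0 := by simp
  have e2 : (2 * (((0 : ℕ) : ℝ) + (css.length : ℕ)) * (h : ℝ)) = 2 * css.length * (h : ℝ) := by simp
  rw [e1, e2] at hm
  obtain ⟨h1, h2⟩ := hm
  have hSr : (0 : ℝ) < S := by exact_mod_cast hS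
  have hloR : (lo : ℝ) * S ≤ ((fullPanelsI S h q (certDataE S h D K Ke ke Kl E css 0).1 0).lo : ℝ) := by
    exact_mod_cast hlo
  have hhiR : ((fullPanelsI S h q (certDataE S h D K Ke ke Kl E css 0).1 0).hi : ℝ) ≤ (hi : ℝ) * S := by
    exact_mod_cast hhi
  exact ⟨le_of_mul_le_mul_right (hloR.trans h1) hSr, le_of_mul_le_mul_right (h2.trans hhiR) hSr⟩

/-! ### Sharded certificates: one kernel check per panel

Kernel reduction of one large Boolean slows down super-linearly in the amount of Taylor-model arithmetic it
contains; the same certificate split into one `decide` per panel, glued by additivity of the integral over adjacent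
intervals, keeps every kernel check small (op. cit., Sect. 3.3: the integral over `[a,b]` is the sum of the
per-subinterval enclosures). -/

/-- The left end point `2jh` of panel `j`. [folklore] -/
def panelLeft (h : ℚ) (j : ℕ) : ℚ := 2 * j * h

/-- **Segment predicate**: the scaled integral `S·∫_a^b E(t) q(t) dt` lies in `[lo, hi]` and the integrand is interval
integrable on `[a, b]` (the per-subinterval enclosure that op. cit. sums over a decomposition of the integration
domain). [cite: MahboubiMelquiondSibutpinote2016, Sect. 3.3] -/
def SegOK (E : EExpr) (q : Poly) (S : ℕ) (a b : ℚ) (lo hi : ℤ) : Prop :=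
  (lo : ℝ) ≤ S * ∫ t in (a : ℝ)..(b : ℝ), E.toFun t * Poly.eval q t ∧
    S * ∫ t in (a : ℝ)..(b : ℝ), E.toFun t * Poly.eval q t ≤ (hi : ℝ) ∧
      IntervalIntegrable (fun t => E.toFun t * Poly.eval q t) volume (a : ℝ) (b : ℝ)

/-- **The per-panel certificate**: positivity of `S` and `h`, the panel model accepted, and the kernel's panel
enclosure `panelIntegI` inside `[plo, phi]`. [folklore] -/
def panelCheckE (S : ℕ) (h : ℚ) (D K Ke ke Kl : ℕ) (E : EExpr) (q : Poly) (j : ℕ) (cs : List (List ℤ × ℕ))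
    (plo phi : ℤ) : Bool :=
  let r := EExpr.model S h D K Ke ke Kl (panelCentre h j) E cs
  let I := panelIntegI S h r.P (midPoly S r.P) (recenter q h j)
  decide (0 < S) && decide (0 < h) && r.ok && decide (plo ≤ I.lo) && decide (I.hi ≤ phi)

/-- **Soundness of the per-panel certificate.** [cite: MahboubiMelquiondSibutpinote2016, Sect. 3.2 Lemma 3] -/
theorem segOK_of_panelCheckE {S : ℕ} {h : ℚ} {D K Ke ke Kl : ℕ} {E : EExpr} {q : Poly} {j : ℕ}
    {cs : List (List ℤ × ℕ)} {plo phi : ℤ} (hc : panelCheckE S h D K Ke ke Kl E q j cs plo phi = true) :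
    SegOK E q S (panelLeft h j) (panelLeft h (j + 1)) plo phi := by
  unfold panelCheckE at hc
  simp only [Bool.and_eq_true, decide_eq_true_eq] at hc
  obtain ⟨⟨⟨⟨hS, h0⟩, hok⟩, hlo⟩, hhi⟩ := hc
  set W := (EExpr.model S h D K Ke ke Kl (panelCentre h j) E cs).P with hWdef
  have hW : TMem S h (fun u => E.toFun ((panelCentre h j : ℝ) + u)) W :=
    EExpr.tmem_model hS h0.le (panelCentre h j) E cs hok
  have hfi : IntervalIntegrable (fun u => E.toFun ((panelCentre h j : ℝ) + u)) volume (-(h : ℝ)) h :=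
    intervalIntegrable_of_tmem hS h0.le hW ((EExpr.measurable_toFun E).comp (measurable_const.add measurable_id))
  have hm := mem_panelIntegI hS h0.le hW hfi (midPoly S W) (recenter q h j)
  have e1 : -(h : ℝ) + (panelCentre h j : ℝ) = ((panelLeft h j : ℚ) : ℝ) := by
    simp only [panelCentre, panelLeft]; push_cast; ring
  have e2 : (h : ℝ) + (panelCentre h j : ℝ) = ((panelLeft h (j + 1) : ℚ) : ℝ) := by
    simp only [panelCentre, panelLeft]; push_cast; ring
  have hI : IntervalIntegrable (fun t => E.toFun t * Poly.eval q t) volume ((panelLeft h j : ℚ) : ℝ)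
      ((panelLeft h (j + 1) : ℚ) : ℝ) := by
    have h1 := hfi.comp_sub_right ((panelCentre h j : ℝ))
    have e0 : (fun x => E.toFun ((panelCentre h j : ℝ) + (x - (panelCentre h j : ℝ)))) = E.toFun := by
      funext x; congr 1; ring
    rw [e0, e1, e2] at h1
    exact h1.mul_continuousOn (Poly.continuous_eval q).continuousOn
  have e : ∫ u in (-(h : ℝ))..h, E.toFun ((panelCentre h j : ℝ) + u) * Poly.eval (recenter q h j) u =
      ∫ t in ((panelLeft h j : ℚ) : ℝ)..((panelLeft h (j + 1) : ℚ) : ℝ), E.toFun t * Poly.eval q t := by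
    simp_rw [eval_recenter]
    have hs := intervalIntegral.integral_comp_add_left (fun t => E.toFun t * Poly.eval q t)
      ((panelCentre h j : ℝ)) (a := -(h : ℝ)) (b := h)
    rw [hs, ← e1, ← e2]
    congr 1 <;> ring
  rw [e] at hm
  obtain ⟨hm1, hm2⟩ := hm
  have hloR : ((plo : ℤ) : ℝ) ≤ ((panelIntegI S h W (midPoly S W) (recenter q h j)).lo : ℝ) := by
    exact_mod_cast hlo
  have hhiR : ((panelIntegI S h W (midPoly S W) (recenter q h j)).hi : ℝ) ≤ ((phi : ℤ) : ℝ) := by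
    exact_mod_cast hhi
  refine ⟨?_, ?_, hI⟩
  · rw [mul_comm]; exact hloR.trans hm1
  · rw [mul_comm]; exact hm2.trans hhiR

/-- **Gluing two adjacent segments**: enclosures of the integral over adjacent subintervals add up to an enclosure over
their union. [cite: MahboubiMelquiondSibutpinote2016, Sect. 3.3] -/
theorem SegOK.append {E : EExpr} {q : Poly} {S : ℕ} {a b c : ℚ} {lo₁ hi₁ lo₂ hi₂ : ℤ}
    (h₁ : SegOK E q S a b lo₁ hi₁) (h₂ : SegOK E q S b c lo₂ hi₂) : SegOK E q S a c (lo₁ + lo₂) (hi₁ + hi₂) := by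
  obtain ⟨l1, u1, i1⟩ := h₁
  obtain ⟨l2, u2, i2⟩ := h₂
  refine ⟨?_, ?_, i1.trans i2⟩
  · rw [← intervalIntegral.integral_add_adjacent_intervals i1 i2, mul_add]; push_cast; linarith
  · rw [← intervalIntegral.integral_add_adjacent_intervals i1 i2, mul_add]; push_cast; linarith

/-- From a segment to bounds on the integral itself (`lo' · S ≤ lo`, `hi ≤ hi' · S`).
[cite: MahboubiMelquiondSibutpinote2016, Sect. 3.2 Lemma 3, Sect. 3.3] -/
theorem SegOK.bounds {E : EExpr} {q : Poly} {S : ℕ} {a b : ℚ} {lo hi : ℤ} (hs : SegOK E q S a b lo hi)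
    (hS : 0 < S) {lo' hi' : ℚ} (hlo : lo' * S ≤ lo) (hhi : (hi : ℚ) ≤ hi' * S) :
    (lo' : ℝ) ≤ ∫ t in (a : ℝ)..(b : ℝ), E.toFun t * Poly.eval q t ∧
      ∫ t in (a : ℝ)..(b : ℝ), E.toFun t * Poly.eval q t ≤ (hi' : ℝ) := by
  obtain ⟨l, u, -⟩ := hs
  have hSr : (0 : ℝ) < S := by exact_mod_cast hS
  have hloR : (lo' : ℝ) * S ≤ (lo : ℝ) := by exact_mod_cast hlo
  have hhiR : (hi : ℝ) ≤ (hi' : ℝ) * S := by exact_mod_cast hhi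
  rw [mul_comm (S : ℝ)] at l u
  exact ⟨le_of_mul_le_mul_right (hloR.trans l) hSr, le_of_mul_le_mul_right (u.trans hhiR) hSr⟩

end PolyMP

end Literature.Analysis.ValidatedNumerics
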